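import Summits.RiemannHypothesis.RiemannHypothesis.Theorems.JensenPolynomialsFarGumbelDiscShrink
import Summits.RiemannHypothesis.RiemannHypothesis.Theorems.JensenPolynomialsFarGumbelAmplitude
import Summits.RiemannHypothesis.RiemannHypothesis.Theorems.JensenPolynomialsFarGumbelWindow
import Mathlib.Analysis.Complex.ExponentialBounds

/-!
# Route `JensenPolynomials`, FAR crux `XiWindowZeroFreeRelFar` (B1-rel far) — S3 pointwise input (C): the vertical
CONNECTOR at `Re u = υ − 2` is `e^{−Λ}`-negligible against the saddle value (RH-FREE; cell rh-jensen, HUMAN RULING D-0040)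

For hypothesis (C) `hconn` of eng-4 g3's master assembly `FarGumbel.laplaceFar_of_pointwise`
(`JensenPolynomialsFarGumbelAssembly.lean`, item `stmt-RiemannHypothesis-19465`, stub S3 `stub_laplaceFar` of theory g8's line
«far-gumbel»): for the far mode `υ ≥ 189/20` (`4πe^{4υ}υ = 2M + 9υ`, `Λ = farLam υ = πe^{4υ}`), `‖a‖ ≤ (9/25)υ²`, ANY point
`u_s = x_s + iy_s` of the saddle box `|x_s − υ| ≤ 3/20`, `|y_s| ≤ 1/10`, and every `|t| ≤ 1/10`:

  `‖Φ_C(υ−2+it)·(υ−2+it)·((υ−2+it)² + a)^{M−½}‖ ≤ e^{−Λ}·e^{Re Ψ(u_s)}`     (`connector_pointwise_le`, `Ψ = farPsi M a`),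

whence `‖connector integral‖ ≤ e^{−Λ}e^{Re Ψ(u_s)}·|y_s|` (`connector_le`, through eng-4 g3's `connector_le_of_pointwise`).
MECHANISM (no saddle analysis, only the disc geometry of `u² + a = (υ² + a) + (u² − υ²)`): the DISC SHRINK
`‖v − r‖ ≤ (1 − 25r/34)‖v‖` for `‖v − 1‖ ≤ 9/25`, `0 ≤ r ≤ ½` (`norm_sub_le_shrink`) gives
`‖(υ−2+it)² + a‖ ≤ (1 − 47/(20υ))·‖υ² + a‖` while `‖u_s² + a‖ ≥ (1 − 4/(5υ))·‖υ² + a‖`; with `M − ½ = 2Λυ − (9υ+1)/2` the ratio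
to the power `M − ½` is `≤ e^{−3.1Λ + 7.1}`, which beats the only loss `πe^{4x_s}cos 4y_s ≤ e^{3/5}Λ ≤ 1.823Λ` hidden in
`e^{Re Ψ(u_s)}`, the amplitude `‖Φ_C‖ ≤ 2‖Φ₁‖` (eng-4 g3's `norm_phiRatio_sub_one_le`) and `e^{9(υ−2−x_s)} ≤ e^{−16.65}`.
(Theory g8's numerics: the connector is `e^{−5Λ}…e^{−7Λ}` below the saddle value; `e^{−Λ}` is all the assembly needs.)
WHAT THIS IS NOT: an inequality between explicit elementary quantities and the kernel's head; nothing here bears on the zeros of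
`ζ` or the truth of RH. Landed `--supports stmt-RiemannHypothesis-19465 --as helper` by prover-rh-jensen-prover-g5-0.
-/


noncomputable section
-- D-0017: `Summit.RiemannHypothesis.RiemannHypothesis.…` duplicates the namespace BY DESIGN (single-problem summit).
set_option linter.dupNamespace false

namespace Summit.RiemannHypothesis.RiemannHypothesis.Theorems.JensenPolynomials.FarGumbel

open Literature.NumberTheory.LFunctions MeasureTheory Set Filter Complex
open Summit.RiemannHypothesis.RiemannHypothesis.Theorems.JensenPolynomials.WindowEGF
open scoped Real

/-! ## 1. Sizes: the head and `e^{3/5}` -/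

/-- `‖Φ₁(x+iy)‖ = 2π²·e^{9x}·e^{−πe^{4x}cos 4y}`. -/
theorem norm_phiHead (x y : ℝ) :
    ‖phiHead ((x : ℂ) + y * I)‖ = 2 * π ^ 2 * Real.exp (9 * x) * Real.exp (-(π * Real.exp (4 * x) * Real.cos (4 * y))) := by
  unfold phiHead
  have h9 : (9 * ((x : ℂ) + y * I)).re = 9 * x := by simp
  have h4re : (4 * ((x : ℂ) + y * I)).re = 4 * x := by simp
  have h4im : (4 * ((x : ℂ) + y * I)).im = 4 * y := by simp
  have hexp : (-((π : ℂ) * Complex.exp (4 * ((x : ℂ) + y * I)))).re = -(π * Real.exp (4 * x) * Real.cos (4 * y)) := by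
    rw [Complex.neg_re, Complex.re_ofReal_mul, Complex.exp_re, h4re, h4im]; ring
  have h2 : ‖(2 : ℂ) * (π : ℂ) ^ 2‖ = 2 * π ^ 2 := by
    rw [norm_mul, norm_pow, Complex.norm_real, Real.norm_of_nonneg Real.pi_pos.le]; simp
  rw [norm_mul, norm_mul, h2, Complex.norm_exp, Complex.norm_exp, h9, hexp]

/-- `e^{3/5} ≤ 1823/1000` (from `e < 2.7182818286` through `(e^{3/5})⁵ = e³`). -/
theorem exp_three_fifths_le : Real.exp (3 / 5) ≤ 1823 / 1000 := by
  by_contra h0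
  have h : (1823 / 1000 : ℝ) < Real.exp (3 / 5) := not_le.mp h0
  have h5 : Real.exp (3 / 5) ^ 5 = Real.exp 1 ^ 3 := by
    rw [← Real.exp_nat_mul, ← Real.exp_nat_mul]; norm_num
  have he : Real.exp 1 < 2.7182818286 := Real.exp_one_lt_d9
  have h3 : Real.exp 1 ^ 3 < 2.7182818286 ^ 3 := by
    exact pow_lt_pow_left₀ he (Real.exp_pos 1).le (by norm_num)
  have h4 : (1823 / 1000 : ℝ) ^ 5 < Real.exp (3 / 5) ^ 5 := pow_lt_pow_left₀ h (by norm_num) (by norm_num)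
  rw [h5] at h4
  have : (1823 / 1000 : ℝ) ^ 5 < 2.7182818286 ^ 3 := h4.trans h3
  norm_num at this

/-! ## 2. The connector bound -/

set_option maxHeartbeats 800000 in -- long chain of explicit norm estimates, no search
/-- **(C) pointwise.** For the far mode `υ` (`υ ≥ 189/20`, `4πe^{4υ}υ = 2M + 9υ`), `‖a‖ ≤ (9/25)υ²`, any `u_s = x_s + iy_s` with
`|x_s − υ| ≤ 3/20`, `|y_s| ≤ 1/10`, and `|t| ≤ 1/10`: the connector integrand at `υ − 2 + it` is at most
`e^{−Λ}·e^{Re Ψ(u_s)}` (`Λ = farLam υ`, `Ψ = farPsi M a`). -/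
theorem connector_pointwise_le (M : ℕ) {υ : ℝ}
    (hυ : (189 / 20 : ℝ) ≤ υ ∧ 4 * Real.pi * Real.exp (4 * υ) * υ = 2 * (M : ℝ) + 9 * υ)
    {a : ℂ} (ha : ‖a‖ ≤ (9 / 25 : ℝ) * υ ^ 2) {x_s y_s : ℝ} (hxs : |x_s - υ| ≤ 3 / 20) (hys : |y_s| ≤ 1 / 10)
    {t : ℝ} (ht : |t| ≤ 1 / 10) :
    ‖deBruijnPhiC ((υ - 2 : ℝ) + t * I) *
        ((((υ - 2 : ℝ) : ℂ) + t * I) * ((((υ - 2 : ℝ) : ℂ) + t * I) ^ 2 + a) ^ ((M : ℂ) - 1 / 2))‖ ≤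
      Real.exp (-farLam υ) * Real.exp (farPsi M a (x_s + y_s * I)).re := by
  obtain ⟨hυ0, hmode⟩ := hυ
  have hυpos : 0 < υ := by linarith
  obtain ⟨hx1, hx2⟩ := abs_le.mp hxs
  obtain ⟨hy1, hy2⟩ := abs_le.mp hys
  obtain ⟨ht1, ht2⟩ := abs_le.mp ht
  have hxs' : υ - 2 ≤ x_s := by linarith
  -- the two points
  set u₁ : ℂ := (((υ - 2 : ℝ)) : ℂ) + t * I with hu₁
  set us : ℂ := (x_s : ℂ) + y_s * I with hus
  -- non-vanishing
  have hs1 : u₁ ^ 2 + a ∈ slitPlane := sq_add_mem_slitPlane hυ0 ha le_rfl ht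
  have hss : us ^ 2 + a ∈ slitPlane := sq_add_mem_slitPlane hυ0 ha hxs' hys
  have hs1ne : u₁ ^ 2 + a ≠ 0 := fun h => Complex.zero_notMem_slitPlane (h ▸ hs1)
  have hssne : us ^ 2 + a ≠ 0 := fun h => Complex.zero_notMem_slitPlane (h ▸ hss)
  have husre : us.re = x_s := by simp [hus]
  have husne : us ≠ 0 := by
    intro h; have := congrArg Complex.re h; rw [husre, Complex.zero_re] at this; linarith
  -- Λ and the exponent `T = M − ½ = 2Λυ − (9υ+1)/2`
  set Λ : ℝ := farLam υ with hΛ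
  have hΛpos : 0 < Λ := by rw [hΛ, farLam]; positivity
  set T : ℝ := (M : ℝ) - 1 / 2 with hT
  have hTeq : T = 2 * Λ * υ - (9 * υ + 1) / 2 := by
    rw [hT, hΛ, farLam]
    have : (M : ℝ) = (4 * Real.pi * Real.exp (4 * υ) * υ - 9 * υ) / 2 := by linarith [hmode]
    rw [this]; ring
  have hT0 : 0 ≤ T := by
    -- `Λ = πe^{4υ} ≥ 3(1 + 4υ)` makes `2Λυ` dominate
    have h1 : 1 + 4 * υ ≤ Real.exp (4 * υ) := by linarith [Real.add_one_le_exp (4 * υ)]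
    have h2 : 3 * (1 + 4 * υ) ≤ Λ := by
      rw [hΛ, farLam]; nlinarith [Real.pi_gt_three, Real.exp_pos (4 * υ)]
    rw [hTeq]; nlinarith
  -- (i) the right-hand side, written out
  have hR : Real.exp (farPsi M a us).re =
      ‖phiHead us‖ * ‖us‖ * ‖us ^ 2 + a‖ ^ T := by
    rw [← Complex.norm_exp, exp_farPsi M a husne hssne,
      show 2 * (π : ℂ) ^ 2 * Complex.exp (9 * us) * Complex.exp (-((π : ℂ) * Complex.exp (4 * us))) = phiHead us
        from rfl, norm_mul, norm_mul, norm_cpow_natCast_sub_half hssne]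
  -- (ii) the left-hand side, written out
  have hL : ‖deBruijnPhiC u₁ * (u₁ * (u₁ ^ 2 + a) ^ ((M : ℂ) - 1 / 2))‖ =
      ‖deBruijnPhiC u₁‖ * (‖u₁‖ * ‖u₁ ^ 2 + a‖ ^ T) := by
    rw [norm_mul, norm_mul, norm_cpow_natCast_sub_half hs1ne]
  -- (iii) the amplitude: `‖Φ_C(u₁)‖ ≤ 2‖Φ₁(u₁)‖ ≤ 4π²e^{9(υ−2)}`
  have hhead_ne := phiHead_ne_zero u₁
  have hQ : ‖deBruijnPhiC u₁ / phiHead u₁ - 1‖ ≤ Real.exp (-4 * (υ - 2)) := norm_phiRatio_sub_one_le hυ0 le_rfl ht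
  have hΦC : ‖deBruijnPhiC u₁‖ ≤ 2 * ‖phiHead u₁‖ := by
    have h1 : ‖deBruijnPhiC u₁ / phiHead u₁‖ ≤ 2 := by
      have hexp1 : Real.exp (-4 * (υ - 2)) ≤ 1 := by
        rw [Real.exp_le_one_iff]; nlinarith
      calc ‖deBruijnPhiC u₁ / phiHead u₁‖ = ‖(deBruijnPhiC u₁ / phiHead u₁ - 1) + 1‖ := by rw [sub_add_cancel]
        _ ≤ ‖deBruijnPhiC u₁ / phiHead u₁ - 1‖ + ‖(1 : ℂ)‖ := norm_add_le _ _
        _ ≤ Real.exp (-4 * (υ - 2)) + 1 := by rw [norm_one]; linarith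
        _ ≤ 2 := by linarith
    rwa [norm_div, div_le_iff₀ (norm_pos_iff.mpr hhead_ne)] at h1
  have hhead1 : ‖phiHead u₁‖ ≤ 2 * π ^ 2 * Real.exp (9 * (υ - 2)) := by
    rw [hu₁, norm_phiHead]
    have hcos : (23 / 25 : ℝ) ≤ Real.cos (4 * t) := cos_four_mul_ge ht
    have hneg : Real.exp (-(π * Real.exp (4 * (υ - 2)) * Real.cos (4 * t))) ≤ 1 := by
      rw [Real.exp_le_one_iff, neg_nonpos]
      have := Real.pi_pos; have := Real.exp_pos (4 * (υ - 2))
      positivity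
    have h0 : 0 ≤ 2 * π ^ 2 * Real.exp (9 * (υ - 2)) := by positivity
    calc 2 * π ^ 2 * Real.exp (9 * (υ - 2)) * Real.exp (-(π * Real.exp (4 * (υ - 2)) * Real.cos (4 * t)))
        ≤ 2 * π ^ 2 * Real.exp (9 * (υ - 2)) * 1 := mul_le_mul_of_nonneg_left hneg h0
      _ = _ := mul_one _
  -- (iv) the head at the saddle box: `‖Φ₁(u_s)‖ ≥ 2π²e^{9x_s}e^{−1.823Λ}`
  have hheads : 2 * π ^ 2 * Real.exp (9 * x_s) * Real.exp (-(1823 / 1000 * Λ)) ≤ ‖phiHead us‖ := by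
    rw [hus, norm_phiHead]
    have hcos1 : Real.cos (4 * y_s) ≤ 1 := Real.cos_le_one _
    have hcos0 : 0 ≤ Real.cos (4 * y_s) := le_trans (by norm_num) (cos_four_mul_ge hys)
    have he : Real.exp (4 * x_s) ≤ 1823 / 1000 * Real.exp (4 * υ) := by
      have h1 : Real.exp (4 * x_s) ≤ Real.exp (3 / 5) * Real.exp (4 * υ) := by
        rw [← Real.exp_add]; exact Real.exp_le_exp.mpr (by linarith)
      exact h1.trans (mul_le_mul_of_nonneg_right exp_three_fifths_le (Real.exp_pos _).le)
    have hloss : π * Real.exp (4 * x_s) * Real.cos (4 * y_s) ≤ 1823 / 1000 * Λ := by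
      rw [hΛ, farLam]
      have hπ := Real.pi_pos
      calc π * Real.exp (4 * x_s) * Real.cos (4 * y_s) ≤ π * Real.exp (4 * x_s) * 1 :=
            mul_le_mul_of_nonneg_left hcos1 (by positivity)
        _ ≤ π * (1823 / 1000 * Real.exp (4 * υ)) * 1 := by
            apply mul_le_mul_of_nonneg_right _ zero_le_one
            exact mul_le_mul_of_nonneg_left he hπ.le
        _ = 1823 / 1000 * (π * Real.exp (4 * υ)) := by ring
    have h0 : 0 ≤ 2 * π ^ 2 * Real.exp (9 * x_s) := by positivity
    apply mul_le_mul_of_nonneg_left _ h0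
    exact Real.exp_le_exp.mpr (by linarith)
  -- (v) sizes of the two points
  have hu₁n : ‖u₁‖ ≤ υ - 19 / 10 := by
    rw [hu₁]
    calc ‖(((υ - 2 : ℝ)) : ℂ) + t * I‖ ≤ ‖(((υ - 2 : ℝ)) : ℂ)‖ + ‖(t : ℂ) * I‖ := norm_add_le _ _
      _ = |υ - 2| + |t| := by
          rw [norm_mul, Complex.norm_I, mul_one, Complex.norm_real, Complex.norm_real, Real.norm_eq_abs,
            Real.norm_eq_abs]
      _ ≤ υ - 19 / 10 := by rw [abs_of_nonneg (by linarith)]; linarith [ht]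
  have husn : υ - 3 / 20 ≤ ‖us‖ := by
    calc υ - 3 / 20 ≤ x_s := by linarith
      _ ≤ |us.re| := by rw [husre]; exact le_abs_self _
      _ ≤ ‖us‖ := Complex.abs_re_le_norm _
  -- (vi) the disc geometry and the power
  set V : ℝ := ‖(υ : ℂ) ^ 2 + a‖ with hV
  have hV0 : 0 < V := lt_of_lt_of_le (by positivity) (norm_sq_add_ge (υ := υ) ha)
  have hN : ‖u₁ ^ 2 + a‖ ≤ (1 - 47 / 20 / υ) * V := by rw [hu₁]; exact norm_connector_sq_add_le hυ0 ha ht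
  have hD : (1 - 4 / 5 / υ) * V ≤ ‖us ^ 2 + a‖ := by rw [hus]; exact norm_saddle_sq_add_ge hυ0 ha hxs hys
  have hk1 : 0 < 1 - 47 / 20 / υ := by
    rw [sub_pos, div_lt_one hυpos]; linarith
  have hk2 : 0 < 1 - 4 / 5 / υ := by
    rw [sub_pos, div_lt_one hυpos]; linarith
  set ρ : ℝ := (1 - 47 / 20 / υ) / (1 - 4 / 5 / υ) with hρ
  have hρpos : 0 < ρ := div_pos hk1 hk2
  have hρ1 : ρ - 1 ≤ -(31 / 20) / υ := by
    rw [hρ, div_sub_one hk2.ne', div_le_iff₀ hk2]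
    have e1 : 1 - 47 / 20 / υ - (1 - 4 / 5 / υ) = -(31 / 20) / υ := by ring
    have e2 : -(31 / 20) / υ * (1 - 4 / 5 / υ) = -(31 / 20) / υ + 31 / 25 / υ ^ 2 := by ring
    have hpos : (0 : ℝ) ≤ 31 / 25 / υ ^ 2 := by positivity
    rw [e1, e2]; linarith
  have hpow : ‖u₁ ^ 2 + a‖ ^ T ≤ ρ ^ T * ‖us ^ 2 + a‖ ^ T := by
    have e : (1 - 47 / 20 / υ) * V = ρ * ((1 - 4 / 5 / υ) * V) := by
      rw [hρ, div_mul_eq_mul_div, eq_div_iff hk2.ne']; ring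
    calc ‖u₁ ^ 2 + a‖ ^ T ≤ ((1 - 47 / 20 / υ) * V) ^ T := Real.rpow_le_rpow (norm_nonneg _) hN hT0
      _ = ρ ^ T * ((1 - 4 / 5 / υ) * V) ^ T := by
          rw [e, Real.mul_rpow hρpos.le (mul_nonneg hk2.le hV0.le)]
      _ ≤ ρ ^ T * ‖us ^ 2 + a‖ ^ T :=
          mul_le_mul_of_nonneg_left (Real.rpow_le_rpow (mul_nonneg hk2.le hV0.le) hD hT0) (Real.rpow_nonneg hρpos.le _)
  have hρT : ρ ^ T ≤ Real.exp (-(31 / 10) * Λ + 71 / 10) := by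
    rw [Real.rpow_def_of_pos hρpos]
    apply Real.exp_le_exp.mpr
    have hlog : Real.log ρ ≤ ρ - 1 := Real.log_le_sub_one_of_pos hρpos
    have h1 : Real.log ρ * T ≤ (-(31 / 20) / υ) * T :=
      mul_le_mul_of_nonneg_right (hlog.trans hρ1) hT0
    have h2 : (-(31 / 20) / υ) * T = -(31 / 10) * Λ + (31 / 20) * (9 / 2 + 1 / (2 * υ)) := by
      rw [hTeq]; field_simp; ring
    have h3 : 1 / (2 * υ) ≤ 10 / 189 := by
      rw [div_le_div_iff₀ (by positivity) (by norm_num)]; linarith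
    linarith [h1, h2, h3]
  -- (vii) assemble
  rw [hL, hR]
  have hP0 : 0 ≤ ‖us ^ 2 + a‖ ^ T := Real.rpow_nonneg (norm_nonneg _) _
  -- LHS ≤ 4π²e^{9(υ−2)} · (υ − 19/10) · e^{−3.1Λ+7.1} · P
  have hLHS : ‖deBruijnPhiC u₁‖ * (‖u₁‖ * ‖u₁ ^ 2 + a‖ ^ T) ≤
      (2 * (2 * π ^ 2 * Real.exp (9 * (υ - 2)))) *
        ((υ - 19 / 10) * (Real.exp (-(31 / 10) * Λ + 71 / 10) * ‖us ^ 2 + a‖ ^ T)) := by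
    have h1 : ‖u₁‖ * ‖u₁ ^ 2 + a‖ ^ T ≤ (υ - 19 / 10) * (Real.exp (-(31 / 10) * Λ + 71 / 10) * ‖us ^ 2 + a‖ ^ T) := by
      apply mul_le_mul hu₁n (hpow.trans (mul_le_mul_of_nonneg_right hρT hP0)) (Real.rpow_nonneg (norm_nonneg _) _)
      linarith
    exact mul_le_mul (hΦC.trans (by linarith [hhead1])) h1 (by positivity) (by positivity)
  -- RHS ≥ e^{−Λ} · 2π²e^{9x_s}e^{−1.823Λ} · (υ − 3/20) · P
  have hRHS : Real.exp (-Λ) * (2 * π ^ 2 * Real.exp (9 * x_s) * Real.exp (-(1823 / 1000 * Λ)) * (υ - 3 / 20) *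
        ‖us ^ 2 + a‖ ^ T) ≤
      Real.exp (-Λ) * (‖phiHead us‖ * ‖us‖ * ‖us ^ 2 + a‖ ^ T) := by
    apply mul_le_mul_of_nonneg_left _ (Real.exp_pos _).le
    apply mul_le_mul_of_nonneg_right _ hP0
    exact mul_le_mul hheads husn (by linarith) (norm_nonneg _)
  refine le_trans hLHS (le_trans ?_ hRHS)
  -- the scalar comparison
  have hcmp : 2 * Real.exp (9 * (υ - 2)) * Real.exp (-(31 / 10) * Λ + 71 / 10) ≤
      Real.exp (-Λ) * (Real.exp (9 * x_s) * Real.exp (-(1823 / 1000 * Λ))) := by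
    rw [← Real.exp_add, mul_assoc, ← Real.exp_add, ← Real.exp_add]
    have h2 : (2 : ℝ) ≤ Real.exp 1 := by
      have := Real.exp_one_gt_d9; linarith
    have hgap : 9 * (υ - 2) + (-(31 / 10) * Λ + 71 / 10) + 1 ≤ -Λ + (9 * x_s + -(1823 / 1000 * Λ)) := by
      nlinarith [hΛpos]
    calc 2 * Real.exp (9 * (υ - 2) + (-(31 / 10) * Λ + 71 / 10))
        ≤ Real.exp 1 * Real.exp (9 * (υ - 2) + (-(31 / 10) * Λ + 71 / 10)) :=
          mul_le_mul_of_nonneg_right h2 (Real.exp_pos _).le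
      _ = Real.exp (9 * (υ - 2) + (-(31 / 10) * Λ + 71 / 10) + 1) := by rw [← Real.exp_add]; ring_nf
      _ ≤ Real.exp (-Λ + (9 * x_s + -(1823 / 1000 * Λ))) := Real.exp_le_exp.mpr hgap
  have hυ' : υ - 19 / 10 ≤ υ - 3 / 20 := by linarith
  have hυ'' : 0 ≤ υ - 19 / 10 := by linarith
  have hπ2 : 0 ≤ 2 * π ^ 2 := by positivity
  calc 2 * (2 * π ^ 2 * Real.exp (9 * (υ - 2))) *
        ((υ - 19 / 10) * (Real.exp (-(31 / 10) * Λ + 71 / 10) * ‖us ^ 2 + a‖ ^ T))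
      = (2 * π ^ 2) * (2 * Real.exp (9 * (υ - 2)) * Real.exp (-(31 / 10) * Λ + 71 / 10)) * (υ - 19 / 10) *
          ‖us ^ 2 + a‖ ^ T := by
        ring
    _ ≤ (2 * π ^ 2) * (Real.exp (-Λ) * (Real.exp (9 * x_s) * Real.exp (-(1823 / 1000 * Λ)))) * (υ - 3 / 20) *
          ‖us ^ 2 + a‖ ^ T := by
        apply mul_le_mul_of_nonneg_right _ hP0
        exact mul_le_mul (mul_le_mul_of_nonneg_left hcmp hπ2) hυ' hυ'' (by positivity)
    _ = Real.exp (-Λ) * (2 * π ^ 2 * Real.exp (9 * x_s) * Real.exp (-(1823 / 1000 * Λ)) * (υ - 3 / 20) *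
          ‖us ^ 2 + a‖ ^ T) := by
        ring

/-- **(C) for the master assembly.** For the far mode `υ`, `‖a‖ ≤ (9/25)υ²` and any `u_s = x_s + iy_s` in the saddle box
(`|x_s − υ| ≤ 3/20`, `|y_s| ≤ 1/10`): the vertical connector integral of `laplaceFar_of_pointwise` satisfies `hconn` with
`E_conn = e^{−Λ}·e^{Re Ψ(u_s)}·|y_s|`. -/
theorem connector_le (M : ℕ) {υ : ℝ}
    (hυ : (189 / 20 : ℝ) ≤ υ ∧ 4 * Real.pi * Real.exp (4 * υ) * υ = 2 * (M : ℝ) + 9 * υ)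
    {a : ℂ} (ha : ‖a‖ ≤ (9 / 25 : ℝ) * υ ^ 2) {x_s y_s : ℝ} (hxs : |x_s - υ| ≤ 3 / 20) (hys : |y_s| ≤ 1 / 10) :
    ‖∫ t in (0 : ℝ)..y_s, deBruijnPhiC ((υ - 2 : ℝ) + t * I) *
        ((((υ - 2 : ℝ) : ℂ) + t * I) * ((((υ - 2 : ℝ) : ℂ) + t * I) ^ 2 + a) ^ ((M : ℂ) - 1 / 2))‖ ≤
      Real.exp (-farLam υ) * Real.exp (farPsi M a (x_s + y_s * I)).re * |y_s| := by
  refine connector_le_of_pointwise M (fun t ht => connector_pointwise_le M hυ ha hxs hys ?_)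
  -- `t ∈ [[0, y_s]]` gives `|t| ≤ |y_s| ≤ 1/10`
  obtain ⟨hy1, hy2⟩ := abs_le.mp hys
  rcases Set.mem_uIcc.mp ht with ⟨h0, h1⟩ | ⟨h0, h1⟩
  · rw [abs_of_nonneg h0]; linarith
  · rw [abs_of_nonpos h1]; linarith

end Summit.RiemannHypothesis.RiemannHypothesis.Theorems.JensenPolynomials.FarGumbel

end
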